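import Literature.Computability.AlgebraicComplexity.GlobalStageExponentCertificate
import HarnessLib

/-!
# The global stage, three regions, at certified rational data
(Vassilevska Williams–Xu–Xu–Zhou 2024, Thm. 5.3 at the parameters of §8) — proved

Topic `Literature/Computability/AlgebraicComplexity`.  `GlobalStageExponentCertificate.lean` certifies
ONE region of the global stage at rational data (`RegionWeights.datum`, `RegionWeights.check`,
`vxxz2024_thm53_certified`); the algorithm uses three regions (the second sharing `Y`-blocks, the third
`X`-blocks), assembled at fixed data in `GlobalStageThreeRegions.vxxz2024_thm53`.  This file is the
three-region certified form, the level-`ℓ*` input of the Procedure of Degeneration of §8 with every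
printed exponent replaced by its certified rational lower bound:

* **`vxxz2024_thm53_certified₃`** — for three rational region data `w₁, w₂, w₃` (written in the
  `Z`-shared orientation) whose certificates check, a common scaling `m ≥ 1` and `0 ≤ ε ≤ 1`:
  `⟨N₁N₂N₃⟩ ⊗ (CW_q^{⊗c})^{⊗(m d₁ + m d₂ + m d₃)} ≥ ⟨κ₁κ₂κ₃⟩ ⊗ 𝒯_{τ₁⧺τ₂⧺τ₃, L₁ ⧺ L₂^{YZ} ⧺ L₃^{XZ}, ε}`
  with `N_r = inputCopies c (m d_r)` and `log₂(κ_r+1) ≥ m d_r (E₀ʳ/Bʳ − epsLoss c ε) − thm53Err c (m d_r)`.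

Everything is proved; no definitions; no named facts.

## References

* V. Vassilevska Williams, Y. Xu, Z. Xu, R. Zhou, *New bounds for matrix multiplication: from alpha
  to omega*, SODA 2024, arXiv:2307.07970 (held: `paper:arxiv-2307.07970`): Thm. 5.3, Prop. 5.1 (three
  regions), §8 (numerical parameters and their verification). [VassilevskaWilliamsXuXuZhou2024]
-/

noncomputable section

open scoped BigOperators

namespace Literature.Computability.AlgebraicComplexity

open Literature.Barriers.MatrixMultiplication (bigCwTensor)

/-- **Thm. 5.3 (three regions) at certified rational data.**  For rational region data `w₁, w₂, w₃`
(the data of the `Y`- and `X`-shared regions written in the `Z`-shared orientation, as in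
`vxxz2024_thm53`) with checking certificates, every `m ≥ 1` and `0 ≤ ε ≤ 1`:
`inputCopies c (m d₁) · inputCopies c (m d₂) · inputCopies c (m d₃)` copies of
`(CW_q^{⊗c})^{⊗(m d₁ + m d₂ + m d₃)}` restrict to `κ₁κ₂κ₃` copies of the level-`ℓ` `ε`-interface tensor
with the concatenated parameter list of the three datums, and
`log₂(κ_r+1) ≥ m d_r (E₀ʳ/Bʳ − epsLoss c ε) − thm53Err c (m d_r)` for `r = 1, 2, 3`.
[cite: VassilevskaWilliamsXuXuZhou2024, Thm. 5.3, Prop. 5.1 and §8] -/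
theorem vxxz2024_thm53_certified₃ (K : Type*) [CommSemiring K] (q : ℕ) {c : ℕ} (hc : 0 < c)
    {w₁ w₂ w₃ : RegionWeights c} {C₁ C₂ C₃ : ExponentCert c}
    (h₁ : w₁.check C₁ = true) (h₂ : w₂.check C₂ = true) (h₃ : w₃.check C₃ = true)
    {m : ℕ} (hm : 0 < m) {ε : ℝ} (hε0 : 0 ≤ ε) (hε1 : ε ≤ 1) :
    ∃ κ₁ κ₂ κ₃ : ℕ,
      TensorRestrictsTo
        (kroneckerTensor
          (unitTensor K (inputCopies c (m * w₁.total) * inputCopies c (m * w₂.total) * inputCopies c (m * w₃.total)))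
          (kroneckerPow (kroneckerPow (bigCwTensor K q) c) (m * w₁.total + m * w₂.total + m * w₃.total)))
        (kroneckerTensor (unitTensor K (κ₁ * κ₂ * κ₃))
          (interfaceTensor K q
            (concatTermMap
              (concatTermMap (w₁.datum (RegionWeights.valid_of_check h₁) m).termMap
                (w₂.datum (RegionWeights.valid_of_check h₂) m).termMap)
              (w₃.datum (RegionWeights.valid_of_check h₃) m).termMap)
            (Fin.append
              (Fin.append (w₁.datum (RegionWeights.valid_of_check h₁) m).termList
                (fun t => ((w₂.datum (RegionWeights.valid_of_check h₂) m).termList t).swapYZ))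
              (fun t => ((w₃.datum (RegionWeights.valid_of_check h₃) m).termList t).swapXZ))
            ε)) ∧
      ((m * w₁.total : ℕ) : ℝ) * ((C₁.E₀ : ℝ) / C₁.B - epsLoss c ε) - thm53Err c (m * w₁.total) ≤ Real.logb 2 ((κ₁ : ℝ) + 1) ∧
      ((m * w₂.total : ℕ) : ℝ) * ((C₂.E₀ : ℝ) / C₂.B - epsLoss c ε) - thm53Err c (m * w₂.total) ≤ Real.logb 2 ((κ₂ : ℝ) + 1) ∧
      ((m * w₃.total : ℕ) : ℝ) * ((C₃.E₀ : ℝ) / C₃.B - epsLoss c ε) - thm53Err c (m * w₃.total) ≤ Real.logb 2 ((κ₃ : ℝ) + 1) := by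
  have hv₁ := RegionWeights.valid_of_check h₁
  have hv₂ := RegionWeights.valid_of_check h₂
  have hv₃ := RegionWeights.valid_of_check h₃
  obtain ⟨hd₁, -, -, -⟩ := w₁.valid_iff.1 hv₁
  obtain ⟨hd₂, -, -, -⟩ := w₂.valid_iff.1 hv₂
  obtain ⟨hd₃, -, -, -⟩ := w₃.valid_iff.1 hv₃
  obtain ⟨κ₁, κ₂, κ₃, hres, b₁, b₂, b₃⟩ := vxxz2024_thm53 K q hc (Nat.mul_pos hm hd₁) (Nat.mul_pos hm hd₂) (Nat.mul_pos hm hd₃)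
    (w₁.datum hv₁ m) (w₂.datum hv₂ m) (w₃.datum hv₃ m) hε0 hε1
  refine ⟨κ₁, κ₂, κ₃, hres, le_trans ?_ b₁, le_trans ?_ b₂, le_trans ?_ b₃⟩
  · have hE := RegionWeights.le_exponent_datum_of_check h₁ hv₁ hm
    have hnR : (0 : ℝ) ≤ ((m * w₁.total : ℕ) : ℝ) := by positivity
    nlinarith
  · have hE := RegionWeights.le_exponent_datum_of_check h₂ hv₂ hm
    have hnR : (0 : ℝ) ≤ ((m * w₂.total : ℕ) : ℝ) := by positivity
    nlinarith
  · have hE := RegionWeights.le_exponent_datum_of_check h₃ hv₃ hm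
    have hnR : (0 : ℝ) ≤ ((m * w₃.total : ℕ) : ℝ) := by positivity
    nlinarith

end Literature.Computability.AlgebraicComplexity
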